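import Summits.Ventures.PercRepro.ProfilePointedCircuitClassesStarSharpC
import Summits.Ventures.PercRepro.ProfilePointedCircuitClassesStarSharpM
import Summits.Ventures.PercRepro.ProfilePointedCircuitClassesTwelveSeriesD

/-!
# PercRepro — (★) ON ELEVEN POINTS WITH TWO DISJOINT SERIES PAIRS IS TWICE THE SHARP STATEMENT ON EACH NINE-POINT
MINOR; THE THREE-SERIES-PAIR REGIME OF THE TWELVE-POINT STATEMENT MODULO THE EIGHT-POINT-CATALOGUE PROP
`StarNineSharp` (p5, gen 52; `proofs/P5-GM1.md` §79 ADDENDUM 2)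

By the cell count of the module StarSharpC, the (★)-defect `in_5(e) − in_5(f) − thru_5({e, f})` of an eleven-point
rank-`6` matroid with two disjoint series pairs `{b, b'}`, `{c, c'}` (both surviving in each other's minor) is EXACTLY
`2·SharpDEF(N ／ b ∖ b', c'; e, f) + 2·SharpDEF(N ／ c ∖ c', b'; e, f)`, so **(★) on `N` follows from the Sharp
statement on the two nine-point minors** (`star_of_two_seriesPairs_of_sharp_minors`; under the Prop,
`star_of_two_seriesPairs_of_starNineSharp`).  Hence **the three-series-pair regime of the twelve-point statement**
(§78: 826 of the 930 residual hits of j325084, exhaustively true) **is in the kernel modulo `StarNineSharp`**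
(`inCount_five_le_outCount_six_of_three_seriesPairs_of_starNineSharp`): (★) at `(e, a')` on `N ／ a`, which keeps
the pairs `{b, b'}`, `{c, c'}` (and, by `seriesPair_of_seriesPair_contract`, the no-triple hypotheses), then §66's
`inCount_five_le_outCount_six_of_seriesPair_of_star` — an eight-point dependency instead of §78 ADDENDUM 1's
eleven-point `StarElevenTwoPairs`.
-/

open scoped Matroid

namespace PercRepro.Cogirth

open Finset ThmH Skew Shadow Profile

variable {α : Type} [DecidableEq α] {N : Matroid α} [N.Finite]

section StarSharpD
/-- **(★) ON ELEVEN POINTS WITH TWO DISJOINT SERIES PAIRS FROM THE SHARP STATEMENT ON THE TWO NINE-POINT MINORS**: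
on `#E = 11`, `ρ(E) = 6`, series pairs `{b, b'}`, `{c, c'}` surviving in each other's minor, `e ≠ f` outside them,
`Sharp(Q, c'; e, f)` and `Sharp(P, b'; e, f)` (`Q := N ／ b ∖ b'`, `P := N ／ c ∖ c'`) give
`in_5(e) ≤ in_5(f) + thru_5({e, f})`. -/
theorem star_of_two_seriesPairs_of_sharp_minors (hn : (gr N).card = 11) (hR : rk N (gr N) = 6)
    {b b' c c' e f : α} (h : SeriesPair N b b') (h' : SeriesPair N c c') (hbc : b ≠ c) (hbc' : b ≠ c')
    (hb'c : b' ≠ c) (hb'c' : b' ≠ c') (hQ : SeriesPair ((N ／ ({b} : Set α)) ＼ ({b'} : Set α)) c c')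
    (hP : SeriesPair ((N ／ ({c} : Set α)) ＼ ({c'} : Set α)) b b') (heb : e ≠ b) (heb' : e ≠ b')
    (hec : e ≠ c) (hec' : e ≠ c') (hfb : f ≠ b) (hfb' : f ≠ b') (hfc : f ≠ c) (hfc' : f ≠ c')
    (hsQ : inCount ((N ／ ({b} : Set α)) ＼ ({b'} : Set α)) 4 e +
        thruCount ((N ／ ({b} : Set α)) ＼ ({b'} : Set α)) 4 {c', f} +
        thruCount ((N ／ ({b} : Set α)) ＼ ({b'} : Set α)) 4 {c', e, f} ≤
      inCount ((N ／ ({b} : Set α)) ＼ ({b'} : Set α)) 4 f +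
        thruCount ((N ／ ({b} : Set α)) ＼ ({b'} : Set α)) 4 {e, f} +
        thruCount ((N ／ ({b} : Set α)) ＼ ({b'} : Set α)) 4 {c', e})
    (hsP : inCount ((N ／ ({c} : Set α)) ＼ ({c'} : Set α)) 4 e +
        thruCount ((N ／ ({c} : Set α)) ＼ ({c'} : Set α)) 4 {b', f} +
        thruCount ((N ／ ({c} : Set α)) ＼ ({c'} : Set α)) 4 {b', e, f} ≤
      inCount ((N ／ ({c} : Set α)) ＼ ({c'} : Set α)) 4 f +
        thruCount ((N ／ ({c} : Set α)) ＼ ({c'} : Set α)) 4 {e, f} +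
        thruCount ((N ／ ({c} : Set α)) ＼ ({c'} : Set α)) 4 {b', e}) :
    inCount N 5 e ≤ inCount N 5 f + thruCount N 5 {e, f} := by
  -- the membership predicates and their invariances
  have hPm : ∀ (m x y : α), x ≠ m → y ≠ m → ∀ W : Finset α, m ∈ insert y (W.erase x) ↔ m ∈ W := by
    intro m x y hx hy W
    rw [mem_insert, mem_erase]
    constructor
    · rintro (h1 | ⟨_, h1⟩)
      · exact absurd h1 hy.symm
      · exact h1
    · intro h1; exact Or.inr ⟨hx.symm, h1⟩
  have hLm : ∀ (m x : α), x ≠ m → ∀ Y : Finset α, m ∈ insert x Y ↔ m ∈ Y := by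
    intro m x hx Y
    rw [mem_insert]
    constructor
    · rintro (h1 | h1)
      · exact absurd h1 hx.symm
      · exact h1
    · exact fun h1 => Or.inr h1
  have hPef : ∀ (x y : α), x ≠ e → y ≠ e → x ≠ f → y ≠ f → ∀ W : Finset α,
      ({e, f} : Finset α) ⊆ insert y (W.erase x) ↔ ({e, f} : Finset α) ⊆ W := by
    intro x y hxe hye hxf hyf W
    rw [insert_subset_iff, insert_subset_iff, singleton_subset_iff, singleton_subset_iff, hPm e x y hxe hye,
      hPm f x y hxf hyf]
  have hLef : ∀ (x : α), x ≠ e → x ≠ f → ∀ Y : Finset α,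
      ({e, f} : Finset α) ⊆ insert x Y ↔ ({e, f} : Finset α) ⊆ Y := by
    intro x hxe hxf Y
    rw [insert_subset_iff, insert_subset_iff, singleton_subset_iff, singleton_subset_iff, hLm e x hxe, hLm f x hxf]
  have Ie := card_filter_eq_of_two_seriesPairs hn hR h h' hbc hbc' hb'c hb'c' hP (fun W => e ∈ W)
    (hPm e b b' heb.symm heb'.symm) (hPm e b' b heb'.symm heb.symm) (hPm e c c' hec.symm hec'.symm)
    (hPm e c' c hec'.symm hec.symm) (hLm e b heb.symm) (hLm e c hec.symm)
  have If := card_filter_eq_of_two_seriesPairs hn hR h h' hbc hbc' hb'c hb'c' hP (fun W => f ∈ W)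
    (hPm f b b' hfb.symm hfb'.symm) (hPm f b' b hfb'.symm hfb.symm) (hPm f c c' hfc.symm hfc'.symm)
    (hPm f c' c hfc'.symm hfc.symm) (hLm f b hfb.symm) (hLm f c hfc.symm)
  have Ief := card_filter_eq_of_two_seriesPairs hn hR h h' hbc hbc' hb'c hb'c' hP
    (fun W => ({e, f} : Finset α) ⊆ W)
    (hPef b b' heb.symm heb'.symm hfb.symm hfb'.symm) (hPef b' b heb'.symm heb.symm hfb'.symm hfb.symm)
    (hPef c c' hec.symm hec'.symm hfc.symm hfc'.symm) (hPef c' c hec'.symm hec.symm hfc'.symm hfc.symm)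
    (hLef b heb.symm hfb.symm) (hLef c hec.symm hfc.symm)
  -- the `c`-cells of `Q` as `thruCount`s, and `thru^Q({c', S}) = thru^Q({c, S})`
  have hnQ : (gr ((N ／ ({b} : Set α)) ＼ ({b'} : Set α))).card =
      rk ((N ／ ({b} : Set α)) ＼ ({b'} : Set α)) (gr ((N ／ ({b} : Set α)) ＼ ({b'} : Set α))) + (3 + 1) := by
    have h1 := card_gr_minor_add_two_of_seriesPair h
    have h2 := rk_gr_minor_add_one_of_seriesPair h
    omega
  have hce : c ∉ ({e} : Finset α) := by rw [mem_singleton]; exact hec.symm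
  have hc'e : c' ∉ ({e} : Finset α) := by rw [mem_singleton]; exact hec'.symm
  have hcf : c ∉ ({f} : Finset α) := by rw [mem_singleton]; exact hfc.symm
  have hc'f : c' ∉ ({f} : Finset α) := by rw [mem_singleton]; exact hfc'.symm
  have hcef : c ∉ ({e, f} : Finset α) := by
    rw [mem_insert, mem_singleton]; rintro (h1 | h1); exact hec h1.symm; exact hfc h1.symm
  have hc'ef : c' ∉ ({e, f} : Finset α) := by
    rw [mem_insert, mem_singleton]; rintro (h1 | h1); exact hec' h1.symm; exact hfc' h1.symm
  have q1 := thruCount_insert_eq_thruCount_minor_of_seriesPair' hQ hnQ hce hc'e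
  have q1' := thruCount_insert_left_eq_thruCount_minor_of_seriesPair hQ hnQ hce
  have q2 := thruCount_insert_eq_thruCount_minor_of_seriesPair' hQ hnQ hcf hc'f
  have q2' := thruCount_insert_left_eq_thruCount_minor_of_seriesPair hQ hnQ hcf
  have q3 := thruCount_insert_eq_thruCount_minor_of_seriesPair' hQ hnQ hcef hc'ef
  have q3' := thruCount_insert_left_eq_thruCount_minor_of_seriesPair hQ hnQ hcef
  -- the filters `p ∧ c ∈ Y` of `Q` are the `thruCount`s `{c, …}`
  have fe : ((biIndepSets ((N ／ ({b} : Set α)) ＼ ({b'} : Set α)) 4).filter (fun Y => e ∈ Y ∧ c ∈ Y)).card =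
      thruCount ((N ／ ({b} : Set α)) ＼ ({b'} : Set α)) 4 {c, e} := by
    unfold thruCount
    apply congrArg
    apply filter_congr
    intro Y _
    rw [insert_subset_iff, singleton_subset_iff]
    exact and_comm
  have ff : ((biIndepSets ((N ／ ({b} : Set α)) ＼ ({b'} : Set α)) 4).filter (fun Y => f ∈ Y ∧ c ∈ Y)).card =
      thruCount ((N ／ ({b} : Set α)) ＼ ({b'} : Set α)) 4 {c, f} := by
    unfold thruCount
    apply congrArg
    apply filter_congr
    intro Y _
    rw [insert_subset_iff, singleton_subset_iff]
    exact and_comm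
  have fef : ((biIndepSets ((N ／ ({b} : Set α)) ＼ ({b'} : Set α)) 4).filter
      (fun Y => ({e, f} : Finset α) ⊆ Y ∧ c ∈ Y)).card =
      thruCount ((N ／ ({b} : Set α)) ＼ ({b'} : Set α)) 4 {c, e, f} := by
    unfold thruCount
    apply congrArg
    apply filter_congr
    intro Y _
    rw [insert_subset_iff (a := c)]
    exact and_comm
  -- the sets through `b` of `P` are the sets through `c` of `Q` (both are the sets of `N` through `b` and `c`)
  have hnP : (gr ((N ／ ({c} : Set α)) ＼ ({c'} : Set α))).card =
      rk ((N ／ ({c} : Set α)) ＼ ({c'} : Set α)) (gr ((N ／ ({c} : Set α)) ＼ ({c'} : Set α))) + (3 + 1) := by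
    have h1 := card_gr_minor_add_two_of_seriesPair h'
    have h2 := rk_gr_minor_add_one_of_seriesPair h'
    omega
  have hbe : b ∉ ({e} : Finset α) := by rw [mem_singleton]; exact heb.symm
  have hb'e : b' ∉ ({e} : Finset α) := by rw [mem_singleton]; exact heb'.symm
  have hbf : b ∉ ({f} : Finset α) := by rw [mem_singleton]; exact hfb.symm
  have hb'f : b' ∉ ({f} : Finset α) := by rw [mem_singleton]; exact hfb'.symm
  have hbef : b ∉ ({e, f} : Finset α) := by
    rw [mem_insert, mem_singleton]; rintro (h1 | h1); exact heb h1.symm; exact hfb h1.symm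
  have hb'ef : b' ∉ ({e, f} : Finset α) := by
    rw [mem_insert, mem_singleton]; rintro (h1 | h1); exact heb' h1.symm; exact hfb' h1.symm
  have p1 := thruCount_insert_eq_thruCount_minor_of_seriesPair' hP hnP hbe hb'e
  have p1' := thruCount_insert_left_eq_thruCount_minor_of_seriesPair hP hnP hbe
  have p2 := thruCount_insert_eq_thruCount_minor_of_seriesPair' hP hnP hbf hb'f
  have p2' := thruCount_insert_left_eq_thruCount_minor_of_seriesPair hP hnP hbf
  have p3 := thruCount_insert_eq_thruCount_minor_of_seriesPair' hP hnP hbef hb'ef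
  have p3' := thruCount_insert_left_eq_thruCount_minor_of_seriesPair hP hnP hbef
  -- `thru^P({b, S}) = thru^Q({c, S})`: both count the sets of `N` through `b` and `c` with `S`
  have hn5 : (gr N).card = rk N (gr N) + (4 + 1) := by omega
  have cross : ∀ S : Finset α, b ∉ S → c ∉ S →
      thruCount ((N ／ ({c} : Set α)) ＼ ({c'} : Set α)) 4 (insert b S) =
        thruCount ((N ／ ({b} : Set α)) ＼ ({b'} : Set α)) 4 (insert c S) := by
    intro S hbS hcS
    have hc1 : c ∉ insert b S := by
      rw [mem_insert]; rintro (h1 | h1); exact hbc h1.symm; exact hcS h1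
    have hb1 : b ∉ insert c S := by
      rw [mem_insert]; rintro (h1 | h1); exact hbc h1; exact hbS h1
    have t1 := thruCount_insert_left_eq_thruCount_minor_of_seriesPair h' hn5 (S := insert b S) hc1
    have t2 := thruCount_insert_left_eq_thruCount_minor_of_seriesPair h hn5 (S := insert c S) hb1
    rw [← t1, ← t2]
    unfold thruCount
    apply congrArg
    apply filter_congr
    intro W _
    rw [insert_subset_iff, insert_subset_iff, insert_subset_iff, insert_subset_iff]
    constructor
    · rintro ⟨h1, h2, h3⟩; exact ⟨h2, h1, h3⟩
    · rintro ⟨h1, h2, h3⟩; exact ⟨h2, h1, h3⟩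
  have x1 := cross {e} hbe hce
  have x2 := cross {f} hbf hcf
  have x3 := cross {e, f} hbef hcef
  -- normalise the levels `3 + 1`, `4 + 1` and the singleton counts
  simp only [Nat.reduceAdd] at q1 q1' q2 q2' q3 q3' p1 p1' p2 p2' p3 p3' x1 x2 x3
  rw [thruCount_singleton] at q1 q1' q2 q2' p1 p1' p2 p2'
  have Ie' : inCount N 5 e + 4 * thruCount ((N ／ ({b} : Set α)) ＼ ({b'} : Set α)) 4 {c, e} =
      2 * inCount ((N ／ ({b} : Set α)) ＼ ({b'} : Set α)) 4 e +
        2 * inCount ((N ／ ({c} : Set α)) ＼ ({c'} : Set α)) 4 e := by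
    unfold inCount
    rw [← fe]
    exact Ie
  have If' : inCount N 5 f + 4 * thruCount ((N ／ ({b} : Set α)) ＼ ({b'} : Set α)) 4 {c, f} =
      2 * inCount ((N ／ ({b} : Set α)) ＼ ({b'} : Set α)) 4 f +
        2 * inCount ((N ／ ({c} : Set α)) ＼ ({c'} : Set α)) 4 f := by
    unfold inCount
    rw [← ff]
    exact If
  have Ief' : thruCount N 5 {e, f} + 4 * thruCount ((N ／ ({b} : Set α)) ＼ ({b'} : Set α)) 4 {c, e, f} =
      2 * thruCount ((N ／ ({b} : Set α)) ＼ ({b'} : Set α)) 4 {e, f} +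
        2 * thruCount ((N ／ ({c} : Set α)) ＼ ({c'} : Set α)) 4 {e, f} := by
    rw [← fef]
    unfold thruCount
    exact Ief
  omega

/-- **(★) ON ELEVEN POINTS WITH TWO DISJOINT SERIES PAIRS UNDER `StarNineSharp`**: on `#E = 11`, `ρ(E) = 6`, `N`
coloop-free, with disjoint series pairs `{b, b'}`, `{c, c'}` through whose second points no further series pair
passes, and `e ≠ f` outside the pairs, `in_5(e) ≤ in_5(f) + thru_5({e, f})`. -/
theorem star_of_two_seriesPairs_of_starNineSharp (hS : StarNineSharp α) (hn : (gr N).card = 11)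
    (hR : rk N (gr N) = 6) (hcf : ∀ x ∈ gr N, rk N ((gr N).erase x) = 6) {b b' c c' e f : α}
    (h : SeriesPair N b b') (h' : SeriesPair N c c') (hbc : b ≠ c) (hbc' : b ≠ c') (hb'c : b' ≠ c)
    (hb'c' : b' ≠ c') (hnob : ∀ x ∈ gr N, x ≠ b → ¬ SeriesPair N b' x)
    (hnoc : ∀ x ∈ gr N, x ≠ c → ¬ SeriesPair N c' x) (he : e ∈ gr N) (hf : f ∈ gr N) (hef : e ≠ f)
    (heb : e ≠ b) (heb' : e ≠ b') (hec : e ≠ c) (hec' : e ≠ c') (hfb : f ≠ b) (hfb' : f ≠ b') (hfc : f ≠ c)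
    (hfc' : f ≠ c') : inCount N 5 e ≤ inCount N 5 f + thruCount N 5 {e, f} := by
  have hcf' : ∀ x ∈ gr N, rk N ((gr N).erase x) = rk N (gr N) := fun x hx => by rw [hcf x hx, hR]
  have hQ := seriesPair_minor_of_seriesPair h h' hcf' hbc hbc' hb'c hb'c' hnob
  have hP := seriesPair_minor_of_seriesPair h' h hcf' hbc.symm hb'c.symm hbc'.symm hb'c'.symm hnoc
  -- the minors: nine points, rank `5`, coloop-free
  have hnQ := card_gr_minor_add_two_of_seriesPair h
  have hRQ := rk_gr_minor_add_one_of_seriesPair h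
  have hnP := card_gr_minor_add_two_of_seriesPair h'
  have hRP := rk_gr_minor_add_one_of_seriesPair h'
  have hcfQ := rk_erase_minor_eq_of_seriesPair h hcf' hnob
  have hcfP := rk_erase_minor_eq_of_seriesPair h' hcf' hnoc
  have hgrQ := gr_minor_of_seriesPair (N := N) b b'
  have hgrP := gr_minor_of_seriesPair (N := N) c c'
  have heQ : e ∈ gr ((N ／ ({b} : Set α)) ＼ ({b'} : Set α)) := by
    rw [hgrQ]; exact mem_erase.2 ⟨heb', mem_erase.2 ⟨heb, he⟩⟩
  have hfQ : f ∈ gr ((N ／ ({b} : Set α)) ＼ ({b'} : Set α)) := by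
    rw [hgrQ]; exact mem_erase.2 ⟨hfb', mem_erase.2 ⟨hfb, hf⟩⟩
  have heP : e ∈ gr ((N ／ ({c} : Set α)) ＼ ({c'} : Set α)) := by
    rw [hgrP]; exact mem_erase.2 ⟨hec', mem_erase.2 ⟨hec, he⟩⟩
  have hfP : f ∈ gr ((N ／ ({c} : Set α)) ＼ ({c'} : Set α)) := by
    rw [hgrP]; exact mem_erase.2 ⟨hfc', mem_erase.2 ⟨hfc, hf⟩⟩
  have hsQ := hS ((N ／ ({b} : Set α)) ＼ ({b'} : Set α)) (by omega) (by omega)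
    (fun x hx => by rw [hcfQ x hx]; omega) c c' e f hQ heQ hfQ hef hec hec' hfc hfc'
  have hsP := hS ((N ／ ({c} : Set α)) ＼ ({c'} : Set α)) (by omega) (by omega)
    (fun x hx => by rw [hcfP x hx]; omega) b b' e f hP heP hfP hef heb heb' hfb hfb'
  exact star_of_two_seriesPairs_of_sharp_minors hn hR h h' hbc hbc' hb'c hb'c' hQ hP heb heb' hec hec' hfb hfb'
    hfc hfc' hsQ hsP

/-- **THE THREE-SERIES-PAIR REGIME OF THE TWELVE-POINT STATEMENT UNDER `StarNineSharp`**: on `#E = 12`, `ρ(E) = 7`,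
`N` coloop-free, with three disjoint series pairs `{a, a'}`, `{b, b'}`, `{c, c'}` (no further series pair through
`b'` or `c'`) and `e` outside them, `in_5(e) ≤ out_6(e)`: (★) at `(e, a')` on `N ／ a` — which keeps `{b, b'}` and
`{c, c'}` — from the Sharp statement on its two nine-point minors, then §66's
`inCount_five_le_outCount_six_of_seriesPair_of_star`. -/
theorem inCount_five_le_outCount_six_of_three_seriesPairs_of_starNineSharp (hS : StarNineSharp α)
    (hn : (gr N).card = 12) (hR : rk N (gr N) = 7) (hcf : ∀ x ∈ gr N, rk N ((gr N).erase x) = 7)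
    {a a' b b' c c' e : α} (h : SeriesPair N a a') (h' : SeriesPair N b b') (h'' : SeriesPair N c c')
    (hab : a ≠ b) (hab' : a ≠ b') (hac : a ≠ c) (hac' : a ≠ c') (ha'b : a' ≠ b) (ha'b' : a' ≠ b') (ha'c : a' ≠ c)
    (ha'c' : a' ≠ c') (hbc : b ≠ c) (hbc' : b ≠ c') (hb'c : b' ≠ c) (hb'c' : b' ≠ c')
    (hnob : ∀ x ∈ gr N, x ≠ b → ¬ SeriesPair N b' x) (hnoc : ∀ x ∈ gr N, x ≠ c → ¬ SeriesPair N c' x)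
    (he : e ∈ gr N) (hea : e ≠ a) (hea' : e ≠ a') (heb : e ≠ b) (heb' : e ≠ b') (hec : e ≠ c) (hec' : e ≠ c') :
    inCount N 5 e ≤ outCount N 6 e := by
  have ha : a ∈ gr N := h.1
  have ha' : a' ∈ gr N := h.2.1
  have haa' : a ≠ a' := h.2.2.1
  have hind := indep_singleton_of_seriesPair h
  have hgr : gr (N ／ ({a} : Set α)) = (gr N).erase a := gr_contract'
  have hn' : (gr (N ／ ({a} : Set α))).card = 11 := by
    rw [hgr, card_erase_of_mem ha, hn]
  have hE := rk_gr_contract_add_one hind ha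
  have hR' : rk (N ／ ({a} : Set α)) (gr (N ／ ({a} : Set α))) = 6 := by omega
  -- `N ／ a` is coloop-free
  have hcf' : ∀ x ∈ gr (N ／ ({a} : Set α)), rk (N ／ ({a} : Set α)) ((gr (N ／ ({a} : Set α))).erase x) = 6 := by
    intro x hx
    rw [hgr] at hx ⊢
    have hxa : x ≠ a := (mem_erase.1 hx).1
    have hxg : x ∈ gr N := (mem_erase.1 hx).2
    have h1 := rk_contract_add_one hind (X := ((gr N).erase a).erase x) (erase_subset _ _)
    have e1 : insert a (((gr N).erase a).erase x) = (gr N).erase x := by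
      rw [erase_right_comm, insert_erase (mem_erase.2 ⟨hxa.symm, ha⟩)]
    rw [e1, hcf x hxg] at h1
    omega
  have hser1 : SeriesPair (N ／ ({a} : Set α)) b b' := seriesPair_contract_of_ne h' ha hab hab' hind
  have hser2 : SeriesPair (N ／ ({a} : Set α)) c c' := seriesPair_contract_of_ne h'' ha hac hac' hind
  -- no further series pair through `b'` or `c'` in `N ／ a`
  have hnob' : ∀ x ∈ gr (N ／ ({a} : Set α)), x ≠ b → ¬ SeriesPair (N ／ ({a} : Set α)) b' x := by
    intro x hx hxb hs
    rw [hgr] at hx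
    exact hnob x (mem_erase.1 hx).2 hxb (seriesPair_of_seriesPair_contract ha hind hab' (mem_erase.1 hx).1.symm hs)
  have hnoc' : ∀ x ∈ gr (N ／ ({a} : Set α)), x ≠ c → ¬ SeriesPair (N ／ ({a} : Set α)) c' x := by
    intro x hx hxc hs
    rw [hgr] at hx
    exact hnoc x (mem_erase.1 hx).2 hxc (seriesPair_of_seriesPair_contract ha hind hac' (mem_erase.1 hx).1.symm hs)
  have he' : e ∈ gr (N ／ ({a} : Set α)) := by rw [hgr]; exact mem_erase.2 ⟨hea, he⟩
  have ha'' : a' ∈ gr (N ／ ({a} : Set α)) := by rw [hgr]; exact mem_erase.2 ⟨haa'.symm, ha'⟩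
  have hstar := star_of_two_seriesPairs_of_starNineSharp hS hn' hR' hcf' hser1 hser2 hbc hbc' hb'c hb'c' hnob' hnoc'
    he' ha'' hea' heb heb' hec hec' ha'b ha'b' ha'c ha'c'
  exact inCount_five_le_outCount_six_of_seriesPair_of_star hn hR h he hea hea' hstar

/-- **THE THREE-SERIES-PAIR REGIME ON EVERY COLOOP-FREE MATROID UNDER `StarNineSharp`, NO FURTHER HYPOTHESIS**: if a
second series pair passes through `b'` or through `c'`, the series-triple theorem of §66 ADDENDUM 2 decides the
statement at every point; otherwise `inCount_five_le_outCount_six_of_three_seriesPairs_of_starNineSharp` applies. -/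
theorem inCount_five_le_outCount_six_of_three_seriesPairs_of_starNineSharp_all (hS : StarNineSharp α)
    (hn : (gr N).card = 12) (hR : rk N (gr N) = 7) (hcf : ∀ x ∈ gr N, rk N ((gr N).erase x) = 7)
    {a a' b b' c c' e : α} (h : SeriesPair N a a') (h' : SeriesPair N b b') (h'' : SeriesPair N c c')
    (hab : a ≠ b) (hab' : a ≠ b') (hac : a ≠ c) (hac' : a ≠ c') (ha'b : a' ≠ b) (ha'b' : a' ≠ b') (ha'c : a' ≠ c)
    (ha'c' : a' ≠ c') (hbc : b ≠ c) (hbc' : b ≠ c') (hb'c : b' ≠ c) (hb'c' : b' ≠ c') (he : e ∈ gr N) (hea : e ≠ a)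
    (hea' : e ≠ a') (heb : e ≠ b) (heb' : e ≠ b') (hec : e ≠ c) (hec' : e ≠ c') : inCount N 5 e ≤ outCount N 6 e := by
  by_cases htb : ∃ x ∈ gr N, x ≠ b ∧ SeriesPair N b' x
  · obtain ⟨x, _, hxb, hbx⟩ := htb
    exact inCount_five_le_outCount_six_of_seriesTriple_all hn hR h' hbx hxb.symm he
  by_cases htc : ∃ x ∈ gr N, x ≠ c ∧ SeriesPair N c' x
  · obtain ⟨x, _, hxc, hcx⟩ := htc
    exact inCount_five_le_outCount_six_of_seriesTriple_all hn hR h'' hcx hxc.symm he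
  have hnob : ∀ x ∈ gr N, x ≠ b → ¬ SeriesPair N b' x := fun x hx hxb hs => htb ⟨x, hx, hxb, hs⟩
  have hnoc : ∀ x ∈ gr N, x ≠ c → ¬ SeriesPair N c' x := fun x hx hxc hs => htc ⟨x, hx, hxc, hs⟩
  exact inCount_five_le_outCount_six_of_three_seriesPairs_of_starNineSharp hS hn hR hcf h h' h'' hab hab' hac hac'
    ha'b ha'b' ha'c ha'c' hbc hbc' hb'c hb'c' hnob hnoc he hea hea' heb heb' hec hec'

end StarSharpD

end PercRepro.Cogirth
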